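import Summits.RiemannHypothesis.RiemannHypothesis.Theorems.WeilColumnThetaWitness
import HarnessLib

/-!
# THETA kernel certificate, (P_R) Step 6: the `R → ∞` / `k → ∞` bookkeeping of the full-form assembly (RH-FREE)

Cell `rh-explicit`, WEIL column, seat weil-1 gen19 (director-rh ruling 2026-08-26T07:10Z «GO Step 3+6»; THETA-ASSIGN v1.1 §6
Step 6). The assembly proves, for every large `k` and every truncation radius `R ≥ R₀`,

  `Re Q(φ_k) ≤ levelK(k) + archR(R) + β(R)`                                                          (Steps 1–5)

where `levelK(k)` is the prime-side constant of handoff-prove-2's `ThetaParams.re_weilQuadratic_moll_oddTail_le` (p430670) at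
mollifier radius `1/(k+1)`, `archR(R) → P.arch t₀` (the D7 term of the truncated tail, whose `H¹` input is `(√B + √ε_R)²`,
`ε_R → 0`) and `β(R) → 0` (the «bracket», `O(W_R·W_T)`, Steps 2–4). Since the left side does not depend on `R`, this file's
bookkeeping turns that into the ceiling FIN consumes:

* §1 `le_of_forall_le_add_of_tendsto`: `x ≤ main R + β R` for `R ≥ R₀`, `main → L`, `β → 0` ⇒ `x ≤ L`;
  `eventually_le_add_of_tendsto`: `Q k ≤ D k + A` eventually and `D → L` ⇒ `∀ e > 0`, eventually `Q k ≤ L + A + e`;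
* §2 `tendsto_levelK`: the level-`k` constant tends to
  `2E²/(m+½)·Σ Λ(n)n^{−(m+1)} + 2E²·√(e^{−2x₁})·C·(e^{−m/(m+1)}/(m+1) + 1/m²)`, and `levelK_limit_eq` identifies this limit at
  `E = M√u₁`, `x₁ = P.x₁`, `C = rsConst` with **`P.primesC + P.cross`**;
* §3 **`eventually_re_weilQuadratic_phi_le_of_steps`**: from the displayed inequality (as a hypothesis, eventually in `k`, for all
  `R ≥ R₀`) and the two limits, `∀ e > 0, ∀ᶠ k, Re Q(φ_k) ≤ P.primesC + P.cross + P.arch t₀ + e` — the hypothesis `hB` of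
  `ThetaParams.weilSemilocalThreshold_lt_of_full_le` (weil-1, `WeilColumnThetaAtomMollified`) with `B = primesC + cross + arch t₀`,
  and `loss t₀ < gain J ≤ 2 log q·Itop` then gives `B − 2 log q·Itop + atom < 0`, i.e. UC(q).

Pure real-analysis bookkeeping over the interface names; nothing here bears on the truth of RH.
-/

noncomputable section

set_option linter.dupNamespace false

open Filter Topology Set

namespace Summit.RiemannHypothesis.RiemannHypothesis.Theorems.WeilColumn.ThetaMellin

open Literature.NumberTheory.LFunctions ThetaParams

/-! ## §1 Two generic limit lemmas -/

/-- If `x ≤ main R + β R` for all `R ≥ R₀`, `main R → L` and `β R → 0` as `R → ∞`, then `x ≤ L`. [folklore] -/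
theorem le_of_forall_le_add_of_tendsto {x L R₀ : ℝ} {main β : ℝ → ℝ}
    (h : ∀ R : ℝ, R₀ ≤ R → x ≤ main R + β R) (hmain : Tendsto main atTop (𝓝 L)) (hβ : Tendsto β atTop (𝓝 0)) : x ≤ L := by
  have hlim : Tendsto (fun R ↦ main R + β R) atTop (𝓝 L) := by simpa using hmain.add hβ
  exact ge_of_tendsto hlim ((eventually_ge_atTop R₀).mono fun R hR ↦ h R hR)

/-- If eventually `Q k ≤ D k + A` and `D k → L`, then for every `e > 0`, eventually `Q k ≤ L + A + e`. [folklore] -/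
theorem eventually_le_add_of_tendsto {Q D : ℕ → ℝ} {L A : ℝ} (hQ : ∀ᶠ k : ℕ in atTop, Q k ≤ D k + A)
    (hD : Tendsto D atTop (𝓝 L)) {e : ℝ} (he : 0 < e) : ∀ᶠ k : ℕ in atTop, Q k ≤ L + A + e := by
  filter_upwards [hQ, (tendsto_order.1 hD).2 (L + e) (by linarith)] with k hk hlt
  linarith

/-! ## §2 The level-`k` prime-side constant and its limit -/

/-- `1/(k+1) → 0` pushed through the level-`k` constant of `re_weilQuadratic_moll_oddTail_le`: as `k → ∞`,
`2(Ee^{(2m+1)/(k+1)})²/(m+½)·S + 2(Ee^{(2m+1)/(k+1)})²·√(e^{−2(x₁+1/(k+1))})·K → 2E²/(m+½)·S + 2E²·√(e^{−2x₁})·K`. [folklore] -/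
theorem tendsto_levelK (P : ThetaParams) (E x₁ K S : ℝ) :
    Tendsto (fun k : ℕ ↦
      2 * (E * Real.exp ((2 * P.m + 1) / ((k : ℝ) + 1))) ^ 2 / ((P.m : ℝ) + 1 / 2) * S +
        2 * (E * Real.exp ((2 * P.m + 1) / ((k : ℝ) + 1))) ^ 2 * Real.sqrt (Real.exp (-2 * (x₁ + 1 / ((k : ℝ) + 1)))) * K)
      atTop (𝓝 (2 * E ^ 2 / ((P.m : ℝ) + 1 / 2) * S + 2 * E ^ 2 * Real.sqrt (Real.exp (-2 * x₁)) * K)) := by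
  have h0 : Tendsto (fun k : ℕ ↦ 1 / ((k : ℝ) + 1)) atTop (𝓝 0) := tendsto_one_div_add_atTop_nhds_zero_nat
  -- `e^{(2m+1)/(k+1)} → 1`
  have h1 : Tendsto (fun k : ℕ ↦ Real.exp ((2 * P.m + 1) / ((k : ℝ) + 1))) atTop (𝓝 1) := by
    have hc : Tendsto (fun k : ℕ ↦ (2 * (P.m : ℝ) + 1) * (1 / ((k : ℝ) + 1))) atTop (𝓝 0) := by
      simpa using h0.const_mul (2 * (P.m : ℝ) + 1)
    have h := (Real.continuous_exp.tendsto 0).comp hc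
    rw [Real.exp_zero] at h
    refine h.congr fun k ↦ ?_
    simp only [Function.comp_apply]
    congr 1
    ring
  -- `(E e^{…})² → E²`
  have h2 : Tendsto (fun k : ℕ ↦ (E * Real.exp ((2 * P.m + 1) / ((k : ℝ) + 1))) ^ 2) atTop (𝓝 (E ^ 2)) := by
    have h := (h1.const_mul E).pow 2
    rw [mul_one] at h
    exact h
  -- `√(e^{−2(x₁ + 1/(k+1))}) → √(e^{−2x₁})`
  have h3 : Tendsto (fun k : ℕ ↦ Real.sqrt (Real.exp (-2 * (x₁ + 1 / ((k : ℝ) + 1))))) atTop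
      (𝓝 (Real.sqrt (Real.exp (-2 * x₁)))) := by
    have ha : Tendsto (fun k : ℕ ↦ -2 * (x₁ + 1 / ((k : ℝ) + 1))) atTop (𝓝 (-2 * x₁)) := by
      have h := (h0.const_add x₁).const_mul (-2)
      rw [add_zero] at h
      exact h
    exact (Real.continuous_sqrt.tendsto _).comp ((Real.continuous_exp.tendsto _).comp ha)
  have hA : Tendsto (fun k : ℕ ↦ 2 * (E * Real.exp ((2 * P.m + 1) / ((k : ℝ) + 1))) ^ 2 / ((P.m : ℝ) + 1 / 2) * S)
      atTop (𝓝 (2 * E ^ 2 / ((P.m : ℝ) + 1 / 2) * S)) :=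
    ((h2.const_mul 2).div_const ((P.m : ℝ) + 1 / 2)).mul_const S
  have hB : Tendsto (fun k : ℕ ↦ 2 * (E * Real.exp ((2 * P.m + 1) / ((k : ℝ) + 1))) ^ 2 *
      Real.sqrt (Real.exp (-2 * (x₁ + 1 / ((k : ℝ) + 1)))) * K) atTop (𝓝 (2 * E ^ 2 * Real.sqrt (Real.exp (-2 * x₁)) * K)) :=
    ((h2.const_mul 2).mul h3).mul_const K
  exact hA.add hB

namespace ThetaParams

variable {P : ThetaParams}

/-- **The limit IS the checker's `primesC + cross`**: at `E = M√u₁`, `x₁ = P.x₁` (`u₁ = e^{x₁}`) and `C = rsConst`,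
`2E²/(m+½)·Σ_n Λ(n)n^{−(m+1)} + 2E²·√(e^{−2x₁})·rsConst·(e^{−m/(m+1)}/(m+1) + 1/m²) = P.primesC + P.cross`. [THETA-CERT-cc6 §D6] -/
theorem levelK_limit_eq (P : ThetaParams) :
    2 * (P.M * Real.sqrt P.u₁) ^ 2 / ((P.m : ℝ) + 1 / 2) * vonMangoldtSum (P.m + 1) +
        2 * (P.M * Real.sqrt P.u₁) ^ 2 * Real.sqrt (Real.exp (-2 * P.x₁)) *
          (rsConst * (Real.exp (-((P.m : ℝ) / ((P.m : ℝ) + 1))) / ((P.m : ℝ) + 1) + 1 / (P.m : ℝ) ^ 2)) =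
      P.primesC + P.cross := by
  have hu : 0 < P.u₁ := Real.exp_pos _
  have hsq : (P.M * Real.sqrt P.u₁) ^ 2 = P.M ^ 2 * P.u₁ := by
    rw [mul_pow, Real.sq_sqrt hu.le]
  have hroot : Real.sqrt (Real.exp (-2 * P.x₁)) = P.u₁⁻¹ := by
    have e : Real.exp (-2 * P.x₁) = Real.exp (-P.x₁) ^ 2 := by
      rw [← Real.exp_nat_mul]; ring_nf
    rw [e, Real.sqrt_sq (Real.exp_pos _).le, Real.exp_neg]
    rfl
  have hexp : Real.exp (-((P.m : ℝ) / ((P.m : ℝ) + 1))) = Real.exp (-(P.m : ℝ) / (P.m + 1)) := by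
    congr 1; ring
  have hm : (P.m : ℝ) + 1 / 2 ≠ 0 := by positivity
  have hm2 : (2 : ℝ) * P.m + 1 ≠ 0 := by positivity
  rw [hsq, hroot, hexp]
  unfold primesC cross
  field_simp
  ring

/-- **The level-`k` constant AT THE WITNESS tends to `P.primesC + P.cross`** (`E = M√u₁`, `x₁ = P.x₁`, `C = rsConst`). [THETA-CERT-cc6 §D6] -/
theorem tendsto_levelK_witness (P : ThetaParams) :
    Tendsto (fun k : ℕ ↦
      2 * (P.M * Real.sqrt P.u₁ * Real.exp ((2 * P.m + 1) / ((k : ℝ) + 1))) ^ 2 / ((P.m : ℝ) + 1 / 2) *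
          vonMangoldtSum (P.m + 1) +
        2 * (P.M * Real.sqrt P.u₁ * Real.exp ((2 * P.m + 1) / ((k : ℝ) + 1))) ^ 2 *
          Real.sqrt (Real.exp (-2 * (P.x₁ + 1 / ((k : ℝ) + 1)))) *
          (rsConst * (Real.exp (-((P.m : ℝ) / ((P.m : ℝ) + 1))) / ((P.m : ℝ) + 1) + 1 / (P.m : ℝ) ^ 2)))
      atTop (𝓝 (P.primesC + P.cross)) := by
  have h := tendsto_levelK P (P.M * Real.sqrt P.u₁) P.x₁
    (rsConst * (Real.exp (-((P.m : ℝ) / ((P.m : ℝ) + 1))) / ((P.m : ℝ) + 1) + 1 / (P.m : ℝ) ^ 2)) (vonMangoldtSum (P.m + 1))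
  rw [levelK_limit_eq P] at h
  exact h

/-! ## §3 The Step-6 bookkeeping theorem -/

/-- **STEP 6 (the `R → ∞`, `k → ∞` bookkeeping of (P_R)), abstract form.** If eventually in `k`, for every `R ≥ R₀`,
`Re Q(φ_k) ≤ D k + archR R + β R` (Steps 1–5 at truncation radius `R` and mollifier radius `1/(k+1)`), with `D k → L`,
`archR R → P.arch t₀` and `β R → 0`, then for every `e > 0`, eventually in `k`, `Re Q(φ_k) ≤ L + P.arch t₀ + e`.
[THETA-ASSIGN v1.1 §6 Step 6] -/
theorem eventually_re_weilQuadratic_phi_le_of_steps {R₀ t₀ L : ℝ} {D : ℕ → ℝ} {archR β : ℝ → ℝ}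
    (hsteps : ∀ᶠ k : ℕ in atTop, ∀ R : ℝ, R₀ ≤ R → (weilQuadratic (P.phi k)).re ≤ D k + archR R + β R)
    (hD : Tendsto D atTop (𝓝 L)) (harch : Tendsto archR atTop (𝓝 (P.arch t₀))) (hβ : Tendsto β atTop (𝓝 0))
    {e : ℝ} (he : 0 < e) :
    ∀ᶠ k : ℕ in atTop, (weilQuadratic (P.phi k)).re ≤ L + P.arch t₀ + e := by
  -- remove `R`: the left side does not depend on it
  have hQ : ∀ᶠ k : ℕ in atTop, (weilQuadratic (P.phi k)).re ≤ D k + P.arch t₀ := by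
    filter_upwards [hsteps] with k hk
    exact le_of_forall_le_add_of_tendsto (main := fun R ↦ D k + archR R) (β := β) (fun R hR ↦ hk R hR)
      (harch.const_add (D k)) hβ
  exact eventually_le_add_of_tendsto hQ hD he

/-- **STEP 6 AT THE WITNESS**: with `D k` = the level-`k` constant of `re_weilQuadratic_moll_oddTail_le` at `E = M√u₁`,
`x₁ = P.x₁`, `C = rsConst`, the ceiling is **`Re Q(φ_k) ≤ P.primesC + P.cross + P.arch t₀ + e`** eventually in `k` — the
hypothesis `hB` of `ThetaParams.weilSemilocalThreshold_lt_of_full_le` with `B = primesC + cross + arch t₀`. [THETA-ASSIGN v1.1 §6 Step 6] -/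
theorem eventually_re_weilQuadratic_phi_le_of_steps_witness {R₀ t₀ : ℝ} {archR β : ℝ → ℝ}
    (hsteps : ∀ᶠ k : ℕ in atTop, ∀ R : ℝ, R₀ ≤ R →
      (weilQuadratic (P.phi k)).re ≤
        (2 * (P.M * Real.sqrt P.u₁ * Real.exp ((2 * P.m + 1) / ((k : ℝ) + 1))) ^ 2 / ((P.m : ℝ) + 1 / 2) *
              vonMangoldtSum (P.m + 1) +
            2 * (P.M * Real.sqrt P.u₁ * Real.exp ((2 * P.m + 1) / ((k : ℝ) + 1))) ^ 2 *
              Real.sqrt (Real.exp (-2 * (P.x₁ + 1 / ((k : ℝ) + 1)))) *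
              (rsConst * (Real.exp (-((P.m : ℝ) / ((P.m : ℝ) + 1))) / ((P.m : ℝ) + 1) + 1 / (P.m : ℝ) ^ 2))) +
          archR R + β R)
    (harch : Tendsto archR atTop (𝓝 (P.arch t₀))) (hβ : Tendsto β atTop (𝓝 0)) {e : ℝ} (he : 0 < e) :
    ∀ᶠ k : ℕ in atTop, (weilQuadratic (P.phi k)).re ≤ P.primesC + P.cross + P.arch t₀ + e :=
  eventually_re_weilQuadratic_phi_le_of_steps hsteps (tendsto_levelK_witness P) harch hβ he

/-- The final arithmetic: `loss t₀ < gain J` and `gain J ≤ 2 log q·Itop` give the strict inequality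
`(primesC + cross + arch t₀) − 2 log q·Itop + atom < 0` that `weilSemilocalThreshold_lt_of_full_le` consumes. [THETA-CERT-cc6 §D9] -/
theorem full_ceiling_lt {t₀ : ℝ} {J : ℕ} (hlg : P.loss t₀ < P.gain J) (hgain : P.gain J ≤ 2 * Real.log P.q * P.Itop) :
    (P.primesC + P.cross + P.arch t₀) - 2 * Real.log P.q * P.Itop + P.atom < 0 := by
  rw [loss_eq] at hlg
  linarith

end ThetaParams

end Summit.RiemannHypothesis.RiemannHypothesis.Theorems.WeilColumn.ThetaMellin

end
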